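import Summits.NavierStokesRegularity.NavierStokesRegularity.Theorems.EulerZoomLiouvillePowerGaugeEulerLiouvilleWeakHighSetFar
import Summits.NavierStokesRegularity.NavierStokesRegularity.Theorems.EulerZoomLiouvillePowerGaugeEulerLiouvilleSelfSimilarBernoulliSqueezeSharpPast

/-!
# THE BERNOULLI HIGH SETS OF A WEAK CLASS PROFILE ARE THIN (rate `1+2ρ`, no regularity, no hypothesis) — hence «JETS MUST TURN» holds
# UNCONDITIONALLY for every level of every exactly self-similar class member
# (crux `EulerZoomLiouville.PowerGaugeEulerLiouville` = stmt-NavierStokesRegularity-19832, line `birth`, open stub `stub_selfSimilarWeakRest`)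

Width seat `ns-ezl-w1` (g7) under the crux LEAD.  A far Bernoulli-high point is FAST or PRESSURISED (ns-ezl-w5's pointwise
`Loc.norm_ge_of_bernoulliHigh_of_pressure_le`: `‖y‖ ≥ R₃`, `ℋ(y) > h`, `P(y) ≤ ¼γ(1−2γ)‖y‖²` ⇒ `‖V y‖ ≥ a_γ‖y‖`, `a_γ = (√(γ/2) − γ)/2`, for
ANY functions `V, P`); the fast set of a weak class profile is Sobolev-thin (g6 `WeakThin.volume_fastSet_inter_shell_le`, rate `3+3ρ`, from the
`A`/`E` growth and GNS, NO regularity) and the pressurised set is Chebyshev-thin (`Loc.volume_pressureHigh_inter_shell_le`, rate `1+2ρ`, from the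
`D` growth).  Hence:

* **`WeakRenormalized.volume_highSet_inter_shell_le`** / **`…_far_le`** — for a weak class profile (`0 < γ < ½`; `V` with whole-space weak gradient,
  `A`/`E`/`D` large-scale growth) and EVERY level `h`: `vol({ℋ > h} ∩ {L ≤ |y| ≤ 2L}) ≤ K L^{−1−2ρ}` and `vol({ℋ > h} ∩ {R ≤ |y|}) ≤ K′ R^{−1−2ρ}`
  beyond a radius — the weak twin of the `C²` lattice's `BernoulliThinness` (there with continuity);
* **`WeakRenormalized.highSet_thin_and_turning_of_past` / `_of_selfSimilar`** — MEMBER LEVEL, crux hypotheses verbatim, `0 < ρ ≤ ½`, NOTHING ELSE: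
  for every level `h` there are `K ≥ 0`, `ϱ₀ > 0` with (i) `vol({ℋ > h} ∩ {ϱ ≤ |y|}) ≤ K ϱ^{−1−2ρ}` (`ϱ ≥ ϱ₀`) and (ii) the TURNING LAW on every
  far layer, `−3γ·K·(R(R−r))^{(−1−2ρ)/2} ≤ ∫_{ℋ>h} −Dθ_{R,r}[W]` (`0 < r ≤ R`, `ϱ₀² ≤ R(R−r)`): the inflow flux of every Bernoulli high set of a
  genuinely weak exactly self-similar member through every far sphere layer is matched by outflow flux inside the same high set, up to
  `O((R(R−r))^{−(1+2ρ)/2})` — no flow, no regularity, no extra hypothesis.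

WHAT THIS IS NOT: not NS, not E, not the stub — weak-class portrait tools (`--supports` stmt-19832); no summit statement is proved here; 19832 OPEN.
[folklore; ConstantinIgnatovaVicol2026Putative §3.4.1 (3.22), §3.4.3 (3.30)–(3.33); Gagliardo–Nirenberg–Sobolev; Chebyshev]
-/

noncomputable section

set_option linter.dupNamespace false
-- nested operator types (`innerSL … ∘L …`)
set_option maxSynthPendingDepth 3

open MeasureTheory Set Filter Topology Metric Function TopologicalSpace
open scoped ENNReal NNReal RealInnerProductSpace ContDiff

namespace Summit.NavierStokesRegularity.NavierStokesRegularity.Theorems.PowerGaugeEulerLiouville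

open Literature.Analysis Literature.Analysis.FunctionSpaces Literature.Analysis.FluidPDE

namespace WeakRenormalized

variable {V : EuclideanSpace ℝ (Fin 3) → EuclideanSpace ℝ (Fin 3)} {P : EuclideanSpace ℝ (Fin 3) → ℝ}
  {G : EuclideanSpace ℝ (Fin 3) → EuclideanSpace ℝ (Fin 3) →L[ℝ] EuclideanSpace ℝ (Fin 3)}

/-! ## High sets are thin: shells and tails -/

section Thin

/-- The fast rate `a_γ = (√(γ/2) − γ)/2` is positive for `0 < γ < ½`. [folklore] -/
theorem fastRate_pos {γ : ℝ} (hγ : 0 < γ) (hγ2 : γ < 1 / 2) : 0 < (Real.sqrt (γ / 2) - γ) / 2 := by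
  have h : γ < Real.sqrt (γ / 2) := by
    rw [Real.lt_sqrt hγ.le]; nlinarith
  linarith

/-- **THE HIGH SETS OF A WEAK CLASS PROFILE ARE THIN ON DYADIC SHELLS (rate `1+2ρ`).**  Let `0 < γ < ½`, `−2 ≤ ρ`; `V` a.e.-strongly measurable with
whole-space weak gradient `G` and the large-scale growth `∫_{B_L}‖V‖² ≤ c_A L^{1−2ρ}`, `∫_{B_L}|G|²_F ≤ c_E L^{1−ρ}` (`L ≥ L₀ ≥ 1`); `P` a.e.-strongly
measurable with `∫_{B_L}|P|^{3/2} ≤ C_D L^{2−2ρ}` (`L ≥ L₁`).  Then for every level `h` there are `K ≥ 0` and `L₂ ≥ 1` with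
`vol({ℋ > h} ∩ {L ≤ ‖y‖ ≤ 2L}) ≤ K L^{−1−2ρ}` for all `L ≥ L₂` (`ℋ = selfSimilarBernoulli γ 0 V P`): a far high point is fast or pressurised,
the fast set is Sobolev-thin and the pressurised set Chebyshev-thin. [folklore] -/
theorem volume_highSet_inter_shell_le {γ ρ : ℝ} (hγ : 0 < γ) (hγ2 : γ < 1 / 2) (hρ : -2 ≤ ρ)
    (hVm : AEStronglyMeasurable V volume) (hVG : HasWeakFDerivOn (⊤ : Opens (EuclideanSpace ℝ (Fin 3))) volume V G)
    {cA cE L₀ : ℝ} (hcA : 0 ≤ cA) (hcE : 0 ≤ cE) (hL₀ : 1 ≤ L₀)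
    (hA : ∀ L : ℝ, L₀ ≤ L → ∫⁻ y in ball (0 : EuclideanSpace ℝ (Fin 3)) L, ‖V y‖ₑ ^ 2 ≤ ENNReal.ofReal (cA * L ^ (1 - 2 * ρ)))
    (hE : ∀ L : ℝ, L₀ ≤ L → ∫⁻ y in ball (0 : EuclideanSpace ℝ (Fin 3)) L, ENNReal.ofReal (frobeniusNormSq (G y)) ≤
      ENNReal.ofReal (cE * L ^ (1 - ρ)))
    (hPm : AEStronglyMeasurable P volume) {CD : ℝ≥0} {L₁ : ℝ}
    (hD : ∀ L : ℝ, L₁ ≤ L → ∫⁻ y in ball (0 : EuclideanSpace ℝ (Fin 3)) L, ‖P y‖ₑ ^ (3 / 2 : ℝ) ≤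
      (CD : ℝ≥0∞) * ENNReal.ofReal (L ^ (2 - 2 * ρ)))
    (h : ℝ) :
    ∃ K L₂ : ℝ, 0 ≤ K ∧ 1 ≤ L₂ ∧ ∀ L : ℝ, L₂ ≤ L →
      volume ({y | h < selfSimilarBernoulli γ 0 V P y} ∩ {y : EuclideanSpace ℝ (Fin 3) | L ≤ ‖y‖ ∧ ‖y‖ ≤ 2 * L}) ≤
        ENNReal.ofReal (K * L ^ (-1 - 2 * ρ)) := by
  set a : ℝ := (Real.sqrt (γ / 2) - γ) / 2 with hadef
  have ha : 0 < a := fastRate_pos hγ hγ2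
  set b : ℝ := γ * (1 - 2 * γ) / 4 with hbdef
  have hb : 0 < b := by rw [hbdef]; nlinarith
  obtain ⟨R₃, hR₃⟩ := Loc.norm_ge_of_bernoulliHigh_of_pressure_le hγ hγ2 V P h
  obtain ⟨K₁, hK₁0, hK₁⟩ := WeakThin.volume_fastSet_inter_shell_le hρ hVm hVG hcA hcE hL₀ hA hE ha
  set C₂ : ℝ := (CD : ℝ) * (3 : ℝ) ^ (2 - 2 * ρ) / b ^ (3 / 2 : ℝ) with hC₂
  have hC₂0 : 0 ≤ C₂ := by positivity
  set L₂ : ℝ := max L₀ (max R₃ (max L₁ 1)) with hL₂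
  have hL₂1 : 1 ≤ L₂ := le_trans (le_trans (le_max_right _ _) (le_max_right _ _)) (le_max_right _ _)
  refine ⟨K₁ + C₂, L₂, by positivity, hL₂1, fun L hL => ?_⟩
  have hLL₀ : L₀ ≤ L := le_trans (le_max_left _ _) hL
  have hLR₃ : R₃ ≤ L := le_trans (le_trans (le_max_left _ _) (le_max_right _ _)) hL
  have hLL₁ : L₁ ≤ L := le_trans (le_trans (le_trans (le_max_left _ _) (le_max_right _ _)) (le_max_right _ _)) hL
  have hL1 : 1 ≤ L := le_trans hL₂1 hL
  have hL0 : 0 < L := lt_of_lt_of_le one_pos hL1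
  set shell : Set (EuclideanSpace ℝ (Fin 3)) := {y | L ≤ ‖y‖ ∧ ‖y‖ ≤ 2 * L} with hshell
  -- a far high point is fast or pressurised
  have hsub : {y | h < selfSimilarBernoulli γ 0 V P y} ∩ shell ⊆
      ({y : EuclideanSpace ℝ (Fin 3) | a * ‖y‖ ≤ ‖V y‖} ∩ shell) ∪ ({y : EuclideanSpace ℝ (Fin 3) | b * ‖y‖ ^ 2 < P y} ∩ shell) := by
    rintro y ⟨hyh, hys⟩
    have hyR : R₃ ≤ ‖y‖ := hLR₃.trans hys.1
    by_cases hP : P y ≤ b * ‖y‖ ^ 2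
    · exact Or.inl ⟨hR₃ y hyR hP hyh, hys⟩
    · exact Or.inr ⟨not_le.1 hP, hys⟩
  have h1 := hK₁ L hLL₀
  have h2 := Loc.volume_pressureHigh_inter_shell_le (ρ := ρ) hPm hD hb hL0 (by linarith)
  have hpow : L ^ (-3 - 3 * ρ) ≤ L ^ (-1 - 2 * ρ) := Real.rpow_le_rpow_of_exponent_le hL1 (by linarith)
  calc volume ({y | h < selfSimilarBernoulli γ 0 V P y} ∩ shell)
      ≤ volume (({y : EuclideanSpace ℝ (Fin 3) | a * ‖y‖ ≤ ‖V y‖} ∩ shell) ∪ ({y : EuclideanSpace ℝ (Fin 3) | b * ‖y‖ ^ 2 < P y} ∩ shell)) :=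
        measure_mono hsub
    _ ≤ volume ({y : EuclideanSpace ℝ (Fin 3) | a * ‖y‖ ≤ ‖V y‖} ∩ shell) +
          volume ({y : EuclideanSpace ℝ (Fin 3) | b * ‖y‖ ^ 2 < P y} ∩ shell) := measure_union_le _ _
    _ ≤ ENNReal.ofReal (K₁ * L ^ (-3 - 3 * ρ)) + ENNReal.ofReal (C₂ * L ^ (-1 - 2 * ρ)) := add_le_add h1 h2
    _ = ENNReal.ofReal (K₁ * L ^ (-3 - 3 * ρ) + C₂ * L ^ (-1 - 2 * ρ)) := (ENNReal.ofReal_add (by positivity) (by positivity)).symm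
    _ ≤ ENNReal.ofReal ((K₁ + C₂) * L ^ (-1 - 2 * ρ)) := by
        apply ENNReal.ofReal_le_ofReal
        nlinarith [mul_le_mul_of_nonneg_left hpow hK₁0]

/-- **THE FAR HIGH SETS OF A WEAK CLASS PROFILE ARE THIN (rate `1+2ρ`, `−½ < ρ`).**  Under the hypotheses of `volume_highSet_inter_shell_le`, for
every level `h` there are `K ≥ 0` and `L₂ ≥ 1` with `vol({ℋ > h} ∩ {R ≤ ‖y‖}) ≤ K R^{−1−2ρ}` for all `R ≥ L₂` (dyadic tails,
`Loc.volume_inter_far_le_of_shell`). [folklore] -/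
theorem volume_highSet_inter_far_le {γ ρ : ℝ} (hγ : 0 < γ) (hγ2 : γ < 1 / 2) (hρ : -1 / 2 < ρ)
    (hVm : AEStronglyMeasurable V volume) (hVG : HasWeakFDerivOn (⊤ : Opens (EuclideanSpace ℝ (Fin 3))) volume V G)
    {cA cE L₀ : ℝ} (hcA : 0 ≤ cA) (hcE : 0 ≤ cE) (hL₀ : 1 ≤ L₀)
    (hA : ∀ L : ℝ, L₀ ≤ L → ∫⁻ y in ball (0 : EuclideanSpace ℝ (Fin 3)) L, ‖V y‖ₑ ^ 2 ≤ ENNReal.ofReal (cA * L ^ (1 - 2 * ρ)))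
    (hE : ∀ L : ℝ, L₀ ≤ L → ∫⁻ y in ball (0 : EuclideanSpace ℝ (Fin 3)) L, ENNReal.ofReal (frobeniusNormSq (G y)) ≤
      ENNReal.ofReal (cE * L ^ (1 - ρ)))
    (hPm : AEStronglyMeasurable P volume) {CD : ℝ≥0} {L₁ : ℝ}
    (hD : ∀ L : ℝ, L₁ ≤ L → ∫⁻ y in ball (0 : EuclideanSpace ℝ (Fin 3)) L, ‖P y‖ₑ ^ (3 / 2 : ℝ) ≤
      (CD : ℝ≥0∞) * ENNReal.ofReal (L ^ (2 - 2 * ρ)))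
    (h : ℝ) :
    ∃ K L₂ : ℝ, 0 ≤ K ∧ 1 ≤ L₂ ∧ ∀ R : ℝ, L₂ ≤ R →
      volume ({y | h < selfSimilarBernoulli γ 0 V P y} ∩ {y : EuclideanSpace ℝ (Fin 3) | R ≤ ‖y‖}) ≤
        ENNReal.ofReal (K * R ^ (-1 - 2 * ρ)) := by
  obtain ⟨K, L₂, hK0, hL₂1, hK⟩ := volume_highSet_inter_shell_le hγ hγ2 (by linarith) hVm hVG hcA hcE hL₀ hA hE hPm hD h
  have hs : -1 - 2 * ρ < 0 := by linarith
  refine ⟨|K| * (1 - (2 : ℝ) ^ (-1 - 2 * ρ))⁻¹, L₂, ?_, hL₂1, fun R hR => ?_⟩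
  · have h2s : (2 : ℝ) ^ (-1 - 2 * ρ) < 1 := Real.rpow_lt_one_of_one_lt_of_neg one_lt_two hs
    have : 0 < 1 - (2 : ℝ) ^ (-1 - 2 * ρ) := by linarith
    positivity
  · exact Loc.volume_inter_far_le_of_shell _ (lt_of_lt_of_le one_pos hL₂1) hs hK hR

end Thin

/-! ## Member level: thin high sets and the unconditional turning law -/

section Member

/-- **EVERY BERNOULLI HIGH SET OF A PAST-EXACT SELF-SIMILAR CLASS MEMBER IS THIN FAR OUT, AND ITS JETS MUST TURN** (`0 < ρ ≤ ½`,
`γ = 1/(2+ρ)`; crux hypotheses verbatim, exact self-similarity about `(T, x₀)` for `τ < T₁`; NO regularity, NO further hypothesis): for every level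
`h` there are `K ≥ 0` and `ϱ₀ > 0` with
(i) `vol({ℋ > h} ∩ {ϱ ≤ ‖y‖}) ≤ K ϱ^{−1−2ρ}` for all `ϱ ≥ ϱ₀`, and
(ii) for every layer `0 < r ≤ R` with `ϱ₀² ≤ R(R−r)`: `−3γ·K·(R(R−r))^{(−1−2ρ)/2} ≤ ∫_{ℋ>h} −Dθ_{R,r}[W]`.
(`Past.profileData_of_past` ⇒ `A`/`E`/`D` growth, weak gradient, Lamb form; `volume_highSet_inter_far_le`; `highSet_flux_turning_law_of_thin`.) [folklore] -/
theorem highSet_thin_and_turning_of_past {ρ : ℝ} (hρ : 0 < ρ) (hρh : ρ ≤ 1 / 2)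
    {T T₁ : ℝ} (hT₁ : T₁ ≤ 0) (hTT₁ : T₁ ≤ T) (x₀ : EuclideanSpace ℝ (Fin 3))
    {u : ℝ → EuclideanSpace ℝ (Fin 3) → EuclideanSpace ℝ (Fin 3)} {p : ℝ → EuclideanSpace ℝ (Fin 3) → ℝ}
    {H : ℝ → EuclideanSpace ℝ (Fin 3) → EuclideanSpace ℝ (Fin 3) →L[ℝ] EuclideanSpace ℝ (Fin 3)} {c : ℝ≥0}
    (hsw : IsSuitableWeakSolutionOn (slab (EuclideanSpace ℝ (Fin 3)) (Iio 0) isOpen_Iio) 0 0 u p)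
    (hH : HasWeakSpatialGradientOn (slab (EuclideanSpace ℝ (Fin 3)) (Iio 0) isOpen_Iio) u H)
    (hgauge : ∀ a : ℝ, 0 < a →
      ENNReal.ofReal (a ^ (2 * ρ)) * cknA a (0 : ℝ × EuclideanSpace ℝ (Fin 3)) u +
          ENNReal.ofReal (a ^ ρ) * cknE a (0 : ℝ × EuclideanSpace ℝ (Fin 3)) H +
        ENNReal.ofReal (a ^ (2 * ρ)) * cknD a (0 : ℝ × EuclideanSpace ℝ (Fin 3)) p ≤ (c : ℝ≥0∞))
    {V : EuclideanSpace ℝ (Fin 3) → EuclideanSpace ℝ (Fin 3)} {P : EuclideanSpace ℝ (Fin 3) → ℝ}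
    (hu : ∀ τ : ℝ, τ < T₁ → u τ = fun x => selfSimilarCollapse (1 / (2 + ρ)) T V τ (x - x₀))
    (hp : ∀ τ : ℝ, τ < T₁ → p τ = fun x => selfSimilarCollapsePressure (1 / (2 + ρ)) T P τ (x - x₀)) (h : ℝ) :
    ∃ K ϱ₀ : ℝ, 0 ≤ K ∧ 0 < ϱ₀ ∧
      (∀ ϱ : ℝ, ϱ₀ ≤ ϱ → volume ({y | h < selfSimilarBernoulli (1 / (2 + ρ)) 0 V P y} ∩
        {y : EuclideanSpace ℝ (Fin 3) | ϱ ≤ ‖y‖}) ≤ ENNReal.ofReal (K * ϱ ^ (-1 - 2 * ρ))) ∧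
      ∀ R r : ℝ, 0 < r → r ≤ R → ϱ₀ ^ 2 ≤ R * (R - r) →
        -(3 * (1 / (2 + ρ)) * (K * (R * (R - r)) ^ ((-1 - 2 * ρ) / 2))) ≤
          ∫ x in {x | h < selfSimilarBernoulli (1 / (2 + ρ)) 0 V P x},
            -(fderiv ℝ (taoCutoff R r) x (selfSimilarTransport (1 / (2 + ρ)) 0 V x)) := by
  have hγpos : 0 < 1 / (2 + ρ) := by positivity
  have hγ0 : 0 ≤ 1 / (2 + ρ) := hγpos.le
  have hγlt : 1 / (2 + ρ) < 1 / 2 := by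
    rw [div_lt_div_iff₀ (by linarith) (by norm_num)]; linarith
  have hγ : 1 / (2 + ρ) ≤ 1 / 2 := hγlt.le
  have hA : ∀ a : ℝ, 0 < a → ENNReal.ofReal (a ^ (2 * ρ)) *
      cknA a (0 : ℝ × EuclideanSpace ℝ (Fin 3)) u ≤ (c : ℝ≥0∞) :=
    fun a ha => le_trans (le_trans le_self_add le_self_add) (hgauge a ha)
  have hE : ∀ a : ℝ, 0 < a → ENNReal.ofReal (a ^ ρ) *
      cknE a (0 : ℝ × EuclideanSpace ℝ (Fin 3)) H ≤ (c : ℝ≥0∞) :=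
    fun a ha => le_trans (le_trans le_add_self le_self_add) (hgauge a ha)
  have hD : ∀ a : ℝ, 0 < a → ENNReal.ofReal (a ^ (2 * ρ)) *
      cknD a (0 : ℝ × EuclideanSpace ℝ (Fin 3)) p ≤ (c : ℝ≥0∞) :=
    fun a ha => le_trans le_add_self (hgauge a ha)
  obtain ⟨G, hVm, hPm, -, hVG, -, ⟨CA, hCA, hAgr⟩, ⟨CE, hCE, hEgr⟩, ⟨CDe, hCDe, hDgr⟩, hV6, hG2, hP32, hdiv, heq, -, -⟩ :=
    Past.profileData_of_past hρ hρh hT₁ hTT₁ x₀ hsw.distributional hH hA hE hD hu hp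
  have hHb := WeakBernoulli.hasWeakFDerivOn_bernoulli hV6 hVG hG2
    (WeakPressure.hasWeakFDerivOn_pressure hVm hPm hV6 hVG hG2 hP32 hdiv heq)
  set L₀ : ℝ := max (2 - T₁) 1 with hL₀
  have hL₀1 : 1 ≤ L₀ := le_max_right _ _
  have hAr : ∀ L : ℝ, L₀ ≤ L → ∫⁻ y in ball (0 : EuclideanSpace ℝ (Fin 3)) L, ‖V y‖ₑ ^ 2 ≤
      ENNReal.ofReal (CA.toReal * L ^ (1 - 2 * ρ)) := fun L hL => by
    rw [ENNReal.ofReal_mul ENNReal.toReal_nonneg, ENNReal.ofReal_toReal hCA]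
    exact hAgr L (le_trans (le_max_left _ _) hL)
  have hEr : ∀ L : ℝ, L₀ ≤ L → ∫⁻ y in ball (0 : EuclideanSpace ℝ (Fin 3)) L, ENNReal.ofReal (frobeniusNormSq (G y)) ≤
      ENNReal.ofReal (CE.toReal * L ^ (1 - ρ)) := fun L hL => by
    rw [ENNReal.ofReal_mul ENNReal.toReal_nonneg, ENNReal.ofReal_toReal hCE]
    exact hEgr L (le_trans (le_max_left _ _) hL)
  have hDr : ∀ L : ℝ, 2 - T₁ ≤ L → ∫⁻ y in ball (0 : EuclideanSpace ℝ (Fin 3)) L, ‖P y‖ₑ ^ (3 / 2 : ℝ) ≤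
      ((CDe.toNNReal : ℝ≥0) : ℝ≥0∞) * ENNReal.ofReal (L ^ (2 - 2 * ρ)) := fun L hL => by
    rw [ENNReal.coe_toNNReal hCDe]
    exact hDgr L hL
  -- (i) thinness of every far high set
  obtain ⟨K, L₂, hK0, hL₂1, hK⟩ := volume_highSet_inter_far_le (ρ := ρ) hγpos hγlt (by linarith) hVm hVG
    ENNReal.toReal_nonneg ENNReal.toReal_nonneg hL₀1 hAr hEr hPm hDr h
  -- the `A`-growth in the form `∫_{B_L}‖V‖² ≤ c_A L`
  have hA1 : ∀ L : ℝ, L₀ ≤ L → ∫ x in ball (0 : EuclideanSpace ℝ (Fin 3)) L, ‖V x‖ ^ 2 ≤ CA.toReal * L := by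
    intro L hL
    have hL1 : 1 ≤ L := le_trans (le_max_right _ _) hL
    haveI : IsFiniteMeasure ((volume : Measure (EuclideanSpace ℝ (Fin 3))).restrict (ball 0 L)) :=
      isFiniteMeasure_restrict.2 measure_ball_lt_top.ne
    have h2 := setIntegral_norm_sq_le_of_lintegral_le (by positivity) ((hV6 L).mono_exponent (by norm_num)) (hAr L hL)
    refine h2.trans (mul_le_mul_of_nonneg_left ?_ ENNReal.toReal_nonneg)
    calc L ^ (1 - 2 * ρ) ≤ L ^ (1 : ℝ) := Real.rpow_le_rpow_of_exponent_le hL1 (by linarith)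
      _ = L := Real.rpow_one L
  have hL₂0 : 0 < L₂ := lt_of_lt_of_le one_pos hL₂1
  refine ⟨K, L₂, hK0, hL₂0, hK, fun R r hr hrR hfar => ?_⟩
  exact highSet_flux_turning_law_of_thin hγ0 hγ hV6 hG2 hP32 hdiv hHb hA1 hK0 hL₂0 hK hr hrR hfar

/-- **EVERY BERNOULLI HIGH SET OF AN EXACTLY SELF-SIMILAR CLASS MEMBER IS THIN FAR OUT, AND ITS JETS MUST TURN** (origin-centred; binder shape of
the skeleton's `IsExactlySelfSimilar`; `0 < ρ ≤ ½`; NO regularity and NO further hypothesis): for every level `h`, (i) `vol({ℋ > h} ∩ {ϱ ≤ ‖y‖}) ≤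
K ϱ^{−1−2ρ}` beyond `ϱ₀`, (ii) `−3γ·K·(R(R−r))^{(−1−2ρ)/2} ≤ ∫_{ℋ>h} −Dθ_{R,r}[W]` on every layer with `ϱ₀² ≤ R(R−r)`. [folklore] -/
theorem highSet_thin_and_turning_of_selfSimilar {ρ : ℝ} (hρ : 0 < ρ) (hρh : ρ ≤ 1 / 2)
    {u : ℝ → EuclideanSpace ℝ (Fin 3) → EuclideanSpace ℝ (Fin 3)} {p : ℝ → EuclideanSpace ℝ (Fin 3) → ℝ}
    {H : ℝ → EuclideanSpace ℝ (Fin 3) → EuclideanSpace ℝ (Fin 3) →L[ℝ] EuclideanSpace ℝ (Fin 3)} {c : ℝ≥0}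
    (hsw : IsSuitableWeakSolutionOn (slab (EuclideanSpace ℝ (Fin 3)) (Iio 0) isOpen_Iio) 0 0 u p)
    (hH : HasWeakSpatialGradientOn (slab (EuclideanSpace ℝ (Fin 3)) (Iio 0) isOpen_Iio) u H)
    (hgauge : ∀ a : ℝ, 0 < a →
      ENNReal.ofReal (a ^ (2 * ρ)) * cknA a (0 : ℝ × EuclideanSpace ℝ (Fin 3)) u +
          ENNReal.ofReal (a ^ ρ) * cknE a (0 : ℝ × EuclideanSpace ℝ (Fin 3)) H +
        ENNReal.ofReal (a ^ (2 * ρ)) * cknD a (0 : ℝ × EuclideanSpace ℝ (Fin 3)) p ≤ (c : ℝ≥0∞))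
    {V : EuclideanSpace ℝ (Fin 3) → EuclideanSpace ℝ (Fin 3)} {P : EuclideanSpace ℝ (Fin 3) → ℝ}
    (hu : ∀ τ : ℝ, τ < 0 → u τ = selfSimilarCollapse (1 / (2 + ρ)) 0 V τ)
    (hp : ∀ τ : ℝ, τ < 0 → p τ = selfSimilarCollapsePressure (1 / (2 + ρ)) 0 P τ) (h : ℝ) :
    ∃ K ϱ₀ : ℝ, 0 ≤ K ∧ 0 < ϱ₀ ∧
      (∀ ϱ : ℝ, ϱ₀ ≤ ϱ → volume ({y | h < selfSimilarBernoulli (1 / (2 + ρ)) 0 V P y} ∩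
        {y : EuclideanSpace ℝ (Fin 3) | ϱ ≤ ‖y‖}) ≤ ENNReal.ofReal (K * ϱ ^ (-1 - 2 * ρ))) ∧
      ∀ R r : ℝ, 0 < r → r ≤ R → ϱ₀ ^ 2 ≤ R * (R - r) →
        -(3 * (1 / (2 + ρ)) * (K * (R * (R - r)) ^ ((-1 - 2 * ρ) / 2))) ≤
          ∫ x in {x | h < selfSimilarBernoulli (1 / (2 + ρ)) 0 V P x},
            -(fderiv ℝ (taoCutoff R r) x (selfSimilarTransport (1 / (2 + ρ)) 0 V x)) := by
  have hu' : ∀ τ : ℝ, τ < 0 → u τ = fun x => selfSimilarCollapse (1 / (2 + ρ)) 0 V τ (x - 0) :=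
    fun τ hτ => by rw [hu τ hτ]; funext x; rw [sub_zero]
  have hp' : ∀ τ : ℝ, τ < 0 → p τ = fun x => selfSimilarCollapsePressure (1 / (2 + ρ)) 0 P τ (x - 0) :=
    fun τ hτ => by rw [hp τ hτ]; funext x; rw [sub_zero]
  exact highSet_thin_and_turning_of_past hρ hρh le_rfl le_rfl 0 hsw hH hgauge hu' hp' h

end Member

end WeakRenormalized

end Summit.NavierStokesRegularity.NavierStokesRegularity.Theorems.PowerGaugeEulerLiouville
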